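import Summits.Ventures.PackingBounds.Configurations.ListConfig

/-!
# Coordinate-list configurations with two orbit types (two row histograms)

Framing: lottery ticket; floor = certified bounds/negative ranges. Venture `PackingBounds` (cell
`pub-packcert`, seat `pub-packcert-energy`).

`ListConfig.lean` turns the kernel checks `shapeOK` / `keysOK` / `histOK L D L` into the cardinality,
the norms, the inner-product table and the energy identity of the configuration `config ι n q L`,
under the assumption that EVERY row of `L` has the same dot-product histogram `D` (true for the
distance-regular sharp configurations). This file is the two-class version needed for
configurations with two kinds of points (e.g. the Cohn–Conway–Elkies–Kumar codes `C_θ ⊂ S³`, with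
`6 + 18` points): `L = r₁ ++ r₂` with `histOK L D₁ r₁` and `histOK L D₂ r₂`. Conclusions:
`card_eq₂`, `inner_mem₂`, `inner_le₂` and the **energy identity**
`Σ_{x ≠ y} a(⟪x,y⟫) = |r₁| Σ_{(d,m) ∈ D₁} m a(ι d/ι q) + |r₂| Σ_{(d,m) ∈ D₂} m a(ι d/ι q)` (`energy_eq₂`).
No new definitions.
-/

namespace Summit.Ventures.PackingBounds.Config

open Finset WithLp

variable {R : Type*} [CommRing R] [DecidableEq R]
variable {ι : R →+* ℝ} {n : ℕ} {q : R} {L r₁ r₂ rows : List (List R)} {D D₁ D₂ : List (R × ℕ)}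

/-- A chunked histogram check `histOK L D rows` says: for a checked row `l ∈ rows`, every dot product
with a member of `L.erase l` is a key of `D`. -/
theorem dot_mem_keys_of_histOK (hH : histOK L D rows = true) {l l' : List R} (hl : l ∈ rows)
    (hl' : l' ∈ L.erase l) : dotL l l' ∈ D.map Prod.fst := by
  simp only [histOK, List.all_eq_true] at hH
  have h := hH l hl
  simp only [rowHistOK, Bool.and_eq_true, List.all_eq_true, List.mem_map] at h
  have h2 := h.2 (dotL l l') ⟨l', hl', rfl⟩
  simpa using h2

omit [CommRing R] in
/-- The table check forbids `q` as a key. -/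
theorem not_mem_keys_of_keysOK (hK : keysOK D q = true) : q ∉ D.map Prod.fst := by
  simp only [keysOK, Bool.and_eq_true, decide_eq_true_eq, List.all_eq_true, Bool.not_eq_true',
    beq_eq_false_iff_ne, ne_eq] at hK
  intro hq
  obtain ⟨p, hp, hpq⟩ := List.mem_map.1 hq
  exact hK.2 p hp hpq

omit [CommRing R] in
/-- The table check gives distinct keys. -/
theorem keys_nodup_of_keysOK (hK : keysOK D q = true) : (D.map Prod.fst).Nodup := by
  simp only [keysOK, Bool.and_eq_true, decide_eq_true_eq] at hK
  exact hK.1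

/-- Two-class version of "off-diagonal dot products differ from `q`": if `L = r₁ ++ r₂` and the rows of
`r₁`, `r₂` are checked against tables `D₁`, `D₂` whose keys avoid `q`, then `l·l' ≠ q` for every
`l ∈ L` and `l' ∈ L.erase l`. -/
theorem dot_ne_of_mem_erase₂ (hK₁ : keysOK D₁ q = true) (hK₂ : keysOK D₂ q = true)
    (hH₁ : histOK L D₁ r₁ = true) (hH₂ : histOK L D₂ r₂ = true) (hL : L = r₁ ++ r₂)
    {l l' : List R} (hl : l ∈ L) (hl' : l' ∈ L.erase l) : dotL l l' ≠ q := by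
  intro hdq
  have hl2 : l ∈ r₁ ++ r₂ := hL ▸ hl
  rcases List.mem_append.1 hl2 with h | h
  · exact not_mem_keys_of_keysOK hK₁ (hdq ▸ dot_mem_keys_of_histOK hH₁ h hl')
  · exact not_mem_keys_of_keysOK hK₂ (hdq ▸ dot_mem_keys_of_histOK hH₂ h hl')

/-- Two-class version of `nodup_of_checks`: `L` has no duplicate rows. -/
theorem nodup₂ (hS : shapeOK L n q = true) (hK₁ : keysOK D₁ q = true) (hK₂ : keysOK D₂ q = true)
    (hH₁ : histOK L D₁ r₁ = true) (hH₂ : histOK L D₂ r₂ = true) (hL : L = r₁ ++ r₂) : L.Nodup := by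
  rw [List.nodup_iff_count_le_one]
  intro a
  by_contra hlt
  push Not at hlt
  have ha : a ∈ L := List.count_pos_iff.1 (by omega)
  have ha2 : a ∈ L.erase a := by
    rw [← List.count_pos_iff, List.count_erase_self]; omega
  exact dot_ne_of_mem_erase₂ hK₁ hK₂ hH₁ hH₂ hL ha ha2 (dot_self_of_shapeOK hS ha)

/-- Two-class version of `vec_injOn`: `vec` is injective on `L`. -/
theorem vec_injOn₂ (hι : Function.Injective ι) (hq : 0 < ι q) (hS : shapeOK L n q = true)
    (hK₁ : keysOK D₁ q = true) (hK₂ : keysOK D₂ q = true)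
    (hH₁ : histOK L D₁ r₁ = true) (hH₂ : histOK L D₂ r₂ = true) (hL : L = r₁ ++ r₂) :
    ∀ l ∈ L, ∀ l' ∈ L, vec ι n q l = vec ι n q l' → l = l' := by
  intro l hl l' hl' he
  by_contra hne
  have hl'e : l' ∈ L.erase l := (List.mem_erase_of_ne (Ne.symm hne)).2 hl'
  have h := inner_vec ι n q hq l l' (length_of_shapeOK hS hl) (length_of_shapeOK hS hl')
  rw [he, real_inner_self_eq_norm_sq,
    norm_vec ι n q hq l' (length_of_shapeOK hS hl') (dot_self_of_shapeOK hS hl'), one_pow,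
    eq_div_iff hq.ne', one_mul] at h
  exact dot_ne_of_mem_erase₂ hK₁ hK₂ hH₁ hH₂ hL hl hl'e (hι h.symm)

/-- Two-class cardinality: the configuration has `|L|` points. -/
theorem card_eq₂ (hι : Function.Injective ι) (hq : 0 < ι q) (hS : shapeOK L n q = true)
    (hK₁ : keysOK D₁ q = true) (hK₂ : keysOK D₂ q = true)
    (hH₁ : histOK L D₁ r₁ = true) (hH₂ : histOK L D₂ r₂ = true) (hL : L = r₁ ++ r₂) :
    (config ι n q L).card = L.length := by
  rw [config, List.toFinset_card_of_nodup (((nodup₂ hS hK₁ hK₂ hH₁ hH₂ hL).map_on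
    (vec_injOn₂ hι hq hS hK₁ hK₂ hH₁ hH₂ hL))), List.length_map]

/-- Two-class inner-product table: distinct points have inner product `ι d / ι q` with `d` a key of
`D₁` or of `D₂`. -/
theorem inner_mem₂ (hq : 0 < ι q) (hS : shapeOK L n q = true)
    (hH₁ : histOK L D₁ r₁ = true) (hH₂ : histOK L D₂ r₂ = true) (hL : L = r₁ ++ r₂) :
    ∀ x ∈ config ι n q L, ∀ y ∈ config ι n q L, x ≠ y →
      ∃ p ∈ D₁ ++ D₂, inner ℝ x y = ι p.1 / ι q := by
  intro x hx y hy hxy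
  obtain ⟨l, hl, rfl⟩ := mem_config.1 hx
  obtain ⟨l', hl', rfl⟩ := mem_config.1 hy
  have hne : l ≠ l' := fun h => hxy (by rw [h])
  have hl'e : l' ∈ L.erase l := (List.mem_erase_of_ne (Ne.symm hne)).2 hl'
  rw [inner_vec ι n q hq l l' (length_of_shapeOK hS hl) (length_of_shapeOK hS hl')]
  have hl2 : l ∈ r₁ ++ r₂ := hL ▸ hl
  rcases List.mem_append.1 hl2 with h | h
  · obtain ⟨p, hp, hpe⟩ := List.mem_map.1 (dot_mem_keys_of_histOK hH₁ h hl'e)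
    exact ⟨p, List.mem_append_left _ hp, by rw [hpe]⟩
  · obtain ⟨p, hp, hpe⟩ := List.mem_map.1 (dot_mem_keys_of_histOK hH₂ h hl'e)
    exact ⟨p, List.mem_append_right _ hp, by rw [hpe]⟩

/-- Two-class bound on inner products: at most `s` as soon as every key of both tables is. -/
theorem inner_le₂ (hq : 0 < ι q) (hS : shapeOK L n q = true)
    (hH₁ : histOK L D₁ r₁ = true) (hH₂ : histOK L D₂ r₂ = true) (hL : L = r₁ ++ r₂)
    (s : ℝ) (hs : ∀ p ∈ D₁ ++ D₂, ι p.1 / ι q ≤ s) :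
    ∀ x ∈ config ι n q L, ∀ y ∈ config ι n q L, x ≠ y → inner ℝ x y ≤ s := by
  intro x hx y hy hxy
  obtain ⟨p, hp, he⟩ := inner_mem₂ hq hS hH₁ hH₂ hL x hx y hy hxy
  exact he ▸ hs p hp

/-- Row energy: for a row `l` checked against the table `D`, `Σ_{y ≠ vec l} a(⟪vec l, y⟫)` over the
configuration equals `Σ_{(d,m) ∈ D} m · a(ι d / ι q)` (given injectivity of `vec` on `L` and no
duplicate rows). -/
theorem rowEnergy_eq (hq : 0 < ι q) (hS : shapeOK L n q = true) (hKn : (D.map Prod.fst).Nodup)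
    (hH : histOK L D rows = true) (hN : L.Nodup)
    (hinj : ∀ l ∈ L, ∀ l' ∈ L, vec ι n q l = vec ι n q l' → l = l')
    {l : List R} (hl : l ∈ rows) (hlL : l ∈ L) (a : ℝ → ℝ) :
    ∑ y ∈ (L.map (vec ι n q)).toFinset.erase (vec ι n q l), a (inner ℝ (vec ι n q l) y) =
      (D.map fun p => (p.2 : ℝ) * a (ι p.1 / ι q)).sum := by
  have hE : (L.map (vec ι n q)).toFinset.erase (vec ι n q l) =
      ((L.erase l).map (vec ι n q)).toFinset := by
    ext y
    simp only [Finset.mem_erase, List.mem_toFinset, List.mem_map]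
    constructor
    · rintro ⟨hy, l', hl', rfl⟩
      exact ⟨l', (hN.mem_erase_iff).2 ⟨fun h => hy (by rw [h]), hl'⟩, rfl⟩
    · rintro ⟨l', hl', rfl⟩
      have h2 := (hN.mem_erase_iff).1 hl'
      exact ⟨fun h => h2.1 (hinj l' h2.2 l hlL h), l', h2.2, rfl⟩
  rw [hE, List.sum_toFinset _ ((hN.erase l).map_on fun x hx y hy hxy =>
    hinj x (List.mem_of_mem_erase hx) y (List.mem_of_mem_erase hy) hxy), List.map_map]
  have hds : ((L.erase l).map ((fun y => a (inner ℝ (vec ι n q l) y)) ∘ vec ι n q)) =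
      (((L.erase l).map (dotL l)).map fun d => a (ι d / ι q)) := by
    rw [List.map_map]
    refine List.map_congr_left fun l' hl' => ?_
    simp only [Function.comp_apply]
    rw [inner_vec ι n q hq l l' (length_of_shapeOK hS hlL)
      (length_of_shapeOK hS (List.mem_of_mem_erase hl'))]
  rw [hds]
  simp only [histOK, List.all_eq_true] at hH
  have h := hH l hl
  simp only [rowHistOK, Bool.and_eq_true, List.all_eq_true, beq_iff_eq] at h
  exact sum_map_eq_of_counts _ _ hKn h.1 (fun d hd => by simpa using h.2 d hd)

/-- **Two-class energy identity.** For every potential `a`, the `a`-energy `Σ_{x ≠ y} a(⟪x,y⟫)` of the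
configuration equals `|r₁| · Σ_{(d,m) ∈ D₁} m · a(ι d / ι q) + |r₂| · Σ_{(d,m) ∈ D₂} m · a(ι d / ι q)`. -/
theorem energy_eq₂ (hι : Function.Injective ι) (hq : 0 < ι q) (hS : shapeOK L n q = true)
    (hK₁ : keysOK D₁ q = true) (hK₂ : keysOK D₂ q = true)
    (hH₁ : histOK L D₁ r₁ = true) (hH₂ : histOK L D₂ r₂ = true) (hL : L = r₁ ++ r₂) (a : ℝ → ℝ) :
    ∑ x ∈ config ι n q L, ∑ y ∈ (config ι n q L).erase x, a (inner ℝ x y) =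
      (r₁.length : ℝ) * (D₁.map fun p => (p.2 : ℝ) * a (ι p.1 / ι q)).sum +
      (r₂.length : ℝ) * (D₂.map fun p => (p.2 : ℝ) * a (ι p.1 / ι q)).sum := by
  have hN := nodup₂ hS hK₁ hK₂ hH₁ hH₂ hL
  have hinj := vec_injOn₂ hι hq hS hK₁ hK₂ hH₁ hH₂ hL
  set S₁ := (D₁.map fun p => (p.2 : ℝ) * a (ι p.1 / ι q)).sum with hS₁
  set S₂ := (D₂.map fun p => (p.2 : ℝ) * a (ι p.1 / ι q)).sum with hS₂
  rw [config, List.sum_toFinset _ (hN.map_on hinj), List.map_map]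
  set G := (fun x => ∑ y ∈ (L.map (vec ι n q)).toFinset.erase x, a (inner ℝ x y)) ∘ vec ι n q
    with hG
  have h1 : ∀ l ∈ r₁, G l = S₁ := fun l hl =>
    rowEnergy_eq hq hS (keys_nodup_of_keysOK hK₁) hH₁ hN hinj hl (hL ▸ List.mem_append_left _ hl) a
  have h2 : ∀ l ∈ r₂, G l = S₂ := fun l hl =>
    rowEnergy_eq hq hS (keys_nodup_of_keysOK hK₂) hH₂ hN hinj hl (hL ▸ List.mem_append_right _ hl) a
  have hsplit : (L.map G).sum = (r₁.map G).sum + (r₂.map G).sum := by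
    rw [hL, List.map_append, List.sum_append]
  rw [hsplit, List.map_congr_left h1, List.map_congr_left h2]
  simp [List.sum_replicate, List.map_const']

end Summit.Ventures.PackingBounds.Config
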